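import Summits.CriticalPhenomena.PercolationContinuityZ3.Theorems.PercNearOneGluingNoHeavyLowerTailAntitheticZones
import Summits.CriticalPhenomena.PercolationContinuityZ3.Theorems.PercNearOneGluingNoHeavyLowerTailAntitheticLatticePieces
import HarnessLib

/-!
# `NoHeavyLowerTail` (stmt-CriticalPhenomena-4575) — antithetic cluster pairs: the ABSTRACT ZONE-SYSTEM THEOREM
# (prim-hp-2 gen 37; MEMO-gen36 §1–§2, §4a; MEMO-gen37 §1)

Support file (`--supports stmt-CriticalPhenomena-4575`, hull-port prover `prim-hp-2`, gen 37).  No named facts, no sorries; standard axioms.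
The `def`s `Antithetic.ZoneSys.{blk, alg, top, part}` are proof-internal bookkeeping (the same objects as `Antithetic.Cone.{zblock, zalg,
ztop, zpart}` of THEOREM I, with the zone map and the boundary colours made parameters); the theorem `Antithetic.zoneSystem_bic_nonneg`
is stated with them only in its hypotheses.

SETTING (MEMO-gen31 §1, MEMO-gen36 §2).  Colourings `T ⊆ Sym2 V` (`T ∩ E` red, `Tᶜ ∩ E` blue), source `s`, red / blue edge clusters
`C_s(T ∩ E)`, `C_s(Tᶜ ∩ E)`, `Δ(T) = (F(red) − F(blue))(G(red) − G(blue))`, constraint set `D(R) = {T : no r ∈ R joined to s in both colours}`,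
`BIC_E(R) = Σ_{D(R)} Δ`.  A ZONE SYSTEM assigns to every `T` and every `r ∈ R` a vertex set `ζ_T(r)` (the zone) and a colour `β_T(r)`
(a `Prop`, "red").  Blocks `S(ζ_T(r))` = non-loop edges of `E` meeting the zone; block algebra `𝒜_T` = edge sets splitting no block; top
`N_T` = `T` recoloured on every block so that `β_T(r)` becomes red, red elsewhere; part `P(T) = {N_T ∆ A : A ∈ 𝒜_T}`.

THEOREM (`Antithetic.zoneSystem_bic_nonneg`).  Suppose that for every `T ∈ D(R)`: (self) `r ∈ ζ_T(r)`; (apex) `s ∉ ζ_T(r)`; (boundary)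
every edge of `E` from outside `ζ_T(r)` into it has colour `β_T(r)`; (consistency) two blocks sharing an edge have the same colour; and
(invariance) for `M ∈ D(R)` agreeing with `T` or with `Tᶜ` on every block of `T`, `ζ_M = ζ_T` on `R` and `β_M(r) = β_T(r)` resp.
`¬ β_T(r)` according to the agreement on the block of `r`.  Then `BIC_E(R) ≥ 0` for all increasing `F, G`.  Proof = THEOREM I's
(…AntitheticCones) verbatim: validity and membership in `D(R)` by SEALING, self-consistency by the invariance hypothesis, Harris on the
block algebra (`piece_algebra_sum_nonneg`), partition principle (`sum_nonneg_of_parts`).  THEOREM I, THEOREM J and THEOREM K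
(…AntitheticApexCone) are instances.
[cite: VandenbergHaggstromKahn2005, §1 p. 6 ("Harris' inequality"), §1 p. 3 (open cluster `C_s`)]
-/

noncomputable section

namespace Summit.CriticalPhenomena.PercolationContinuityZ3.Theorems

open Literature.Probability.Percolation
open scoped Classical symmDiff

namespace Antithetic

namespace ZoneSys

variable {V : Type*}

/-- The BLOCK of a vertex set `Z`: the non-loop edges of `E` meeting `Z`. [this work] -/
def blk (E : Set (Sym2 V)) (Z : Set V) : Set (Sym2 V) := {e | e ∈ E ∧ ¬ e.IsDiag ∧ ∃ x ∈ Z, x ∈ e}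

/-- The block ALGEBRA of a zone map `ζ` on `R`: edge sets splitting no block. [this work] -/
def alg (E : Set (Sym2 V)) (R : Set V) (ζ : V → Set V) : Set (Set (Sym2 V)) :=
  {A | ∀ u ∈ R, blk E (ζ u) ⊆ A ∨ Disjoint (blk E (ζ u)) A}

/-- The TOP colouring: on the block of `ζ u` the colouring `T` recoloured so that the colour `β u` becomes red; red elsewhere.
[this work] -/
def top (E : Set (Sym2 V)) (R : Set V) (ζ : V → Set V) (β : V → Prop) (T : Set (Sym2 V)) : Set (Sym2 V) :=
  {e | ∀ u ∈ R, e ∈ blk E (ζ u) → (e ∈ T ↔ β u)}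

/-- The PART of `T`: the colourings `top ∆ A`, `A` in the block algebra. [this work] -/
def part [Fintype V] (E : Set (Sym2 V)) (R : Set V) (ζ : V → Set V) (β : V → Prop) (T : Set (Sym2 V)) :
    Finset (Set (Sym2 V)) :=
  (Finset.univ.filter fun A => A ∈ alg E R ζ).image fun A => top E R ζ β T ∆ A

section Partition

variable {E : Set (Sym2 V)} {s : V} {R : Set V} {ζ : V → Set V} {β : V → Prop} {T : Set (Sym2 V)}

/-- A non-loop edge of `E` at a zone vertex lies in the block. [this work] -/
theorem mk_mem_blk {Z : Set V} {x y : V} (hxy : s(x, y) ∈ E) (hne : x ≠ y) (h : x ∈ Z ∨ y ∈ Z) : s(x, y) ∈ blk E Z := by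
  refine ⟨hxy, fun hd => hne (Sym2.mk_isDiag_iff.1 hd), ?_⟩
  rcases h with h | h
  · exact ⟨x, h, Sym2.mem_mk_left x y⟩
  · exact ⟨y, h, Sym2.mem_mk_right x y⟩

/-- The top colouring on a block: `e ∈ N ↔ (e ∈ T ↔ β u)` for `e ∈ S(ζ u)`. [this work] -/
theorem mem_top_iff (hcons : ∀ u ∈ R, ∀ v ∈ R, ∀ e, e ∈ blk E (ζ u) → e ∈ blk E (ζ v) → (β u ↔ β v))
    {u : V} (hu : u ∈ R) {e : Sym2 V} (he : e ∈ blk E (ζ u)) :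
    (e ∈ top E R ζ β T ↔ (e ∈ T ↔ β u)) := by
  constructor
  · exact fun h => h u hu he
  · intro h v hv hev
    exact h.trans (hcons u hu v hv e he hev)

/-- Boundary edges of a zone are red in the top colouring. [this work] -/
theorem boundary_mem_top
    (hbd : ∀ u ∈ R, ∀ x, x ∉ ζ u → ∀ y ∈ ζ u, s(x, y) ∈ E → (s(x, y) ∈ T ↔ β u))
    (hcons : ∀ u ∈ R, ∀ v ∈ R, ∀ e, e ∈ blk E (ζ u) → e ∈ blk E (ζ v) → (β u ↔ β v))
    {u : V} (hu : u ∈ R) {x y : V} (hx : x ∉ ζ u) (hy : y ∈ ζ u) (hxy : s(x, y) ∈ E) :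
    s(x, y) ∈ top E R ζ β T := by
  have hne : x ≠ y := fun h => hx (h ▸ hy)
  exact (mem_top_iff hcons hu (mk_mem_blk hxy hne (Or.inr hy))).2 (hbd u hu x hx y hy hxy)

/-- On a block the top colouring flipped by a set of the algebra is `T` or `Tᶜ`. [this work] -/
theorem top_agree (hcons : ∀ u ∈ R, ∀ v ∈ R, ∀ e, e ∈ blk E (ζ u) → e ∈ blk E (ζ v) → (β u ↔ β v))
    {u : V} (hu : u ∈ R) {A : Set (Sym2 V)} (hA : A ∈ alg E R ζ) :
    (∀ e ∈ blk E (ζ u), (e ∈ top E R ζ β T ∆ A ↔ e ∈ T)) ∨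
      (∀ e ∈ blk E (ζ u), (e ∈ top E R ζ β T ∆ A ↔ e ∉ T)) := by
  rcases hA u hu with h | h
  · by_cases hb : β u
    · right
      intro e he
      rw [Set.mem_symmDiff, mem_top_iff hcons hu he]
      have := h he
      tauto
    · left
      intro e he
      rw [Set.mem_symmDiff, mem_top_iff hcons hu he]
      have := h he
      tauto
  · by_cases hb : β u
    · left
      intro e he
      rw [Set.mem_symmDiff, mem_top_iff hcons hu he]
      have := Set.disjoint_left.1 h he
      tauto
    · right
      intro e he
      rw [Set.mem_symmDiff, mem_top_iff hcons hu he]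
      have := Set.disjoint_left.1 h he
      tauto

/-- `T` lies in its own part. [this work] -/
theorem mem_part_self [Fintype V]
    (hcons : ∀ u ∈ R, ∀ v ∈ R, ∀ e, e ∈ blk E (ζ u) → e ∈ blk E (ζ v) → (β u ↔ β v)) :
    T ∈ part E R ζ β T := by
  rw [part, Finset.mem_image]
  refine ⟨top E R ζ β T ∆ T, ?_, symmDiff_symmDiff_cancel_left _ _⟩
  rw [Finset.mem_filter]
  refine ⟨Finset.mem_univ _, fun u hu => ?_⟩
  by_cases hb : β u
  · right
    rw [Set.disjoint_left]
    intro e he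
    rw [Set.mem_symmDiff, mem_top_iff hcons hu he]
    tauto
  · left
    intro e he
    rw [Set.mem_symmDiff, mem_top_iff hcons hu he]
    tauto

/-- **Validity**: along the block algebra the red edge cluster of `N ∆ A` is antitone in `A` — the zones whose blocks lie inside the
larger set are sealed, all other edges are at least as red. [this work] -/
theorem red_antitone (hs : ∀ u ∈ R, s ∉ ζ u)
    (hbd : ∀ u ∈ R, ∀ x, x ∉ ζ u → ∀ y ∈ ζ u, s(x, y) ∈ E → (s(x, y) ∈ T ↔ β u))
    (hcons : ∀ u ∈ R, ∀ v ∈ R, ∀ e, e ∈ blk E (ζ u) → e ∈ blk E (ζ v) → (β u ↔ β v))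
    {A B : Set (Sym2 V)} (hB : B ∈ alg E R ζ) (hAB : A ⊆ B) :
    openEdgeCluster ((top E R ζ β T ∆ B) ∩ E) s ⊆ openEdgeCluster ((top E R ζ β T ∆ A) ∩ E) s := by
  set N := top E R ζ β T with hN
  set J : Set V := {x | ∃ u ∈ R, blk E (ζ u) ⊆ B ∧ x ∈ ζ u} with hJ
  have hsJ : s ∉ J := by
    rintro ⟨u, hu, -, hsu⟩
    exact hs u hu hsu
  refine openEdgeCluster_subset_of_sealed_le _ _ s J hsJ ?_ ?_
  · intro x y hx hy hxy
    refine ⟨?_, hxy.2⟩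
    have heB := hxy.1
    rw [Set.mem_symmDiff] at heB ⊢
    by_cases heA : s(x, y) ∈ A
    · exact Or.inr ⟨heA, fun hn => by rcases heB with ⟨_, h⟩ | ⟨_, h⟩ <;> [exact h (hAB heA); exact h hn]⟩
    · by_cases heB' : s(x, y) ∈ B
      · exfalso
        have hnN : s(x, y) ∉ N := by
          rcases heB with ⟨_, h⟩ | ⟨_, h⟩
          · exact absurd heB' h
          · exact h
        have hex : ∃ v ∈ R, s(x, y) ∈ blk E (ζ v) := by
          by_contra hcon
          apply hnN
          rw [hN]
          intro v hv hev
          exact absurd ⟨v, hv, hev⟩ hcon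
        obtain ⟨v, hv, hev⟩ := hex
        have hvB : blk E (ζ v) ⊆ B := by
          rcases hB v hv with h | h
          · exact h
          · exact absurd (Set.disjoint_left.1 h hev) (not_not.2 heB')
        obtain ⟨-, -, z, hz, hze⟩ := hev
        rcases Sym2.mem_iff.1 hze with rfl | rfl
        · exact hx ⟨v, hv, hvB, hz⟩
        · exact hy ⟨v, hv, hvB, hz⟩
      · rcases heB with ⟨h, _⟩ | ⟨h, _⟩
        · exact Or.inl ⟨h, heA⟩
        · exact absurd h heB'
  · intro x y hx hy hxy
    obtain ⟨u, hu, huB, hyu⟩ := hy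
    have hxu : x ∉ ζ u := fun h => hx ⟨u, hu, huB, h⟩
    have hne : x ≠ y := fun h => hxu (h ▸ hyu)
    have heN : s(x, y) ∈ N := boundary_mem_top hbd hcons hu hxu hyu hxy.2
    have heB : s(x, y) ∈ B := huB (mk_mem_blk hxy.2 hne (Or.inr hyu))
    have := hxy.1
    rw [Set.mem_symmDiff] at this
    rcases this with ⟨_, h⟩ | ⟨_, h⟩
    · exact h heB
    · exact h heN

/-- **Members lie in the constraint set**: in a member of the part of `T`, an `R`-vertex whose zone block is up is not joined to `s`
in blue, one whose block is down is not joined in red (sealing). [this work] -/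
theorem mem_constraint_of_mem_part [Fintype V] (hself : ∀ u ∈ R, u ∈ ζ u) (hs : ∀ u ∈ R, s ∉ ζ u)
    (hbd : ∀ u ∈ R, ∀ x, x ∉ ζ u → ∀ y ∈ ζ u, s(x, y) ∈ E → (s(x, y) ∈ T ↔ β u))
    (hcons : ∀ u ∈ R, ∀ v ∈ R, ∀ e, e ∈ blk E (ζ u) → e ∈ blk E (ζ v) → (β u ↔ β v))
    {M : Set (Sym2 V)} (hM : M ∈ part E R ζ β T) :
    ∀ r ∈ R, ¬ ((openGraph (M ∩ E)).Reachable s r ∧ (openGraph (Mᶜ ∩ E)).Reachable s r) := by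
  rw [part, Finset.mem_image] at hM
  obtain ⟨A, hA, rfl⟩ := hM
  rw [Finset.mem_filter] at hA
  have hA := hA.2
  intro u hu
  have hsJ : s ∉ ζ u := hs u hu
  rcases hA u hu with h | h
  · -- block down: the zone is sealed against red
    rintro ⟨hred, -⟩
    refine not_reachable_of_sealed _ s (ζ u) hsJ ?_ (hself u hu) hred
    intro x y hx hy hxy
    have hne : x ≠ y := fun h' => hx (h' ▸ hy)
    have heN : s(x, y) ∈ top E R ζ β T := boundary_mem_top hbd hcons hu hx hy hxy.2
    have heA : s(x, y) ∈ A := h (mk_mem_blk hxy.2 hne (Or.inr hy))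
    have := hxy.1
    rw [Set.mem_symmDiff] at this
    rcases this with ⟨_, h'⟩ | ⟨_, h'⟩
    · exact h' heA
    · exact h' heN
  · -- block up: the zone is sealed against blue
    rintro ⟨-, hblue⟩
    refine not_reachable_of_sealed _ s (ζ u) hsJ ?_ (hself u hu) hblue
    intro x y hx hy hxy
    have hne : x ≠ y := fun h' => hx (h' ▸ hy)
    have heN : s(x, y) ∈ top E R ζ β T := boundary_mem_top hbd hcons hu hx hy hxy.2
    have heA : s(x, y) ∉ A := fun heA => Set.disjoint_left.1 h (mk_mem_blk hxy.2 hne (Or.inr hy)) heA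
    have := hxy.1
    rw [Set.mem_compl_iff, Set.mem_symmDiff] at this
    exact this (Or.inl ⟨heN, heA⟩)

/-- Every member of the part of `T` agrees with `T` or with `Tᶜ` on every block of `T`. [this work] -/
theorem agree_of_mem_part [Fintype V]
    (hcons : ∀ u ∈ R, ∀ v ∈ R, ∀ e, e ∈ blk E (ζ u) → e ∈ blk E (ζ v) → (β u ↔ β v))
    {M : Set (Sym2 V)} (hM : M ∈ part E R ζ β T) :
    ∀ u ∈ R, (∀ e ∈ blk E (ζ u), (e ∈ M ↔ e ∈ T)) ∨ (∀ e ∈ blk E (ζ u), (e ∈ M ↔ e ∉ T)) := by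
  rw [part, Finset.mem_image] at hM
  obtain ⟨A, hA, rfl⟩ := hM
  rw [Finset.mem_filter] at hA
  exact fun u hu => top_agree hcons hu hA.2

/-- **Parts are constant on themselves**, given invariance of the zone system: if the system `(ζ', β')` at a member `M` has the same
zones as `(ζ, β)` at `T`, and colours equal or opposite according to whether `M` agrees with `T` or with `Tᶜ` on the block, then the
parts coincide. [this work] -/
theorem part_eq_of_inv [Fintype V] {ζ' : V → Set V} {β' : V → Prop} {M : Set (Sym2 V)}
    (hinv : ∀ u ∈ R, ζ' u = ζ u ∧
      (((∀ e ∈ blk E (ζ u), (e ∈ M ↔ e ∈ T)) ∧ (β' u ↔ β u)) ∨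
        ((∀ e ∈ blk E (ζ u), (e ∈ M ↔ e ∉ T)) ∧ (β' u ↔ ¬ β u)))) :
    part E R ζ' β' M = part E R ζ β T := by
  have halg : ∀ B, B ∈ alg E R ζ' ↔ B ∈ alg E R ζ := fun B =>
    forall₂_congr fun u hu => by rw [(hinv u hu).1]
  have htop : top E R ζ' β' M = top E R ζ β T := by
    ext e
    refine forall₂_congr fun u hu => ?_
    rw [(hinv u hu).1]
    refine imp_congr_right fun he => ?_
    rcases (hinv u hu).2 with ⟨h1, h2⟩ | ⟨h1, h2⟩
    · rw [h1 e he, h2]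
    · rw [h1 e he, h2]
      tauto
  rw [part, part, htop]
  congr 1
  ext B
  simp only [Finset.mem_filter, Finset.mem_univ, true_and]
  exact halg B

/-- **Every part has a nonnegative antithetic sum** — Harris on the block algebra with the validity `red_antitone`. [this work] -/
theorem part_sum_nonneg [Fintype V] (hs : ∀ u ∈ R, s ∉ ζ u)
    (hbd : ∀ u ∈ R, ∀ x, x ∉ ζ u → ∀ y ∈ ζ u, s(x, y) ∈ E → (s(x, y) ∈ T ↔ β u))
    (hcons : ∀ u ∈ R, ∀ v ∈ R, ∀ e, e ∈ blk E (ζ u) → e ∈ blk E (ζ v) → (β u ↔ β v))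
    {F G : Set (Sym2 V) → ℝ} (hF : Monotone F) (hG : Monotone G) :
    0 ≤ ∑ M ∈ part E R ζ β T, (F (openEdgeCluster (M ∩ E) s) - F (openEdgeCluster (Mᶜ ∩ E) s)) *
      (G (openEdgeCluster (M ∩ E) s) - G (openEdgeCluster (Mᶜ ∩ E) s)) := by
  rw [part]
  refine piece_algebra_sum_nonneg E s (top E R ζ β T) _ ?_ ?_ ?_ ?_ ?_ hF hG
  · intro A hA B hB
    rw [Finset.mem_filter] at hA hB ⊢
    exact ⟨Finset.mem_univ _, blockAlgebra_inter R (fun u => blk E (ζ u)) hA.2 hB.2⟩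
  · intro A hA B hB
    rw [Finset.mem_filter] at hA hB ⊢
    exact ⟨Finset.mem_univ _, blockAlgebra_union R (fun u => blk E (ζ u)) hA.2 hB.2⟩
  · intro A hA
    rw [Finset.mem_filter] at hA ⊢
    exact ⟨Finset.mem_univ _, blockAlgebra_compl R (fun u => blk E (ζ u)) hA.2⟩
  · rw [Finset.mem_filter]
    exact ⟨Finset.mem_univ _, blockAlgebra_empty R (fun u => blk E (ζ u))⟩
  · intro A hA B hB hAB
    rw [Finset.mem_filter] at hB
    exact red_antitone hs hbd hcons hB.2 hAB

end Partition

end ZoneSys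

section Theorem

variable {V : Type*} [Fintype V]

/-- **The zone-system theorem (prim-hp-2 gen 37).**  `E` an edge set on a finite vertex type, `s` a source, `R` a vertex set (for `s ∈ R` the
constraint set is empty); a zone system
`ζ T r ⊆ V`, `β T r : Prop` (`T` a colouring, `r ∈ R`) such that for every `T` in the constraint set `D(R)`: every `r ∈ R` lies in
its zone and `s` does not; every edge of `E` from outside a zone into it has the zone's colour (`β` = red); blocks sharing an edge
have the same colour; and for every `M ∈ D(R)` agreeing with `T` or with `Tᶜ` on each block of `T` the zones of `M` are those of `T`,
with equal resp. opposite colours.  Then for all increasing `F, G` of the edge cluster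
`0 ≤ Σ_{T ∈ D(R)} (F(C_s(T∩E)) − F(C_s(Tᶜ∩E))) · (G(C_s(T∩E)) − G(C_s(Tᶜ∩E)))`, i.e. `BIC_E(R) ≥ 0`. [this work] -/
theorem zoneSystem_bic_nonneg (E : Set (Sym2 V)) (s : V) (R : Set V)
    (ζ : Set (Sym2 V) → V → Set V) (β : Set (Sym2 V) → V → Prop)
    (hself : ∀ T : Set (Sym2 V), (∀ r ∈ R, ¬ ((openGraph (T ∩ E)).Reachable s r ∧ (openGraph (Tᶜ ∩ E)).Reachable s r)) →
      ∀ u ∈ R, u ∈ ζ T u)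
    (hs : ∀ T : Set (Sym2 V), (∀ r ∈ R, ¬ ((openGraph (T ∩ E)).Reachable s r ∧ (openGraph (Tᶜ ∩ E)).Reachable s r)) →
      ∀ u ∈ R, s ∉ ζ T u)
    (hbd : ∀ T : Set (Sym2 V), (∀ r ∈ R, ¬ ((openGraph (T ∩ E)).Reachable s r ∧ (openGraph (Tᶜ ∩ E)).Reachable s r)) →
      ∀ u ∈ R, ∀ x, x ∉ ζ T u → ∀ y ∈ ζ T u, s(x, y) ∈ E → (s(x, y) ∈ T ↔ β T u))
    (hcons : ∀ T : Set (Sym2 V), (∀ r ∈ R, ¬ ((openGraph (T ∩ E)).Reachable s r ∧ (openGraph (Tᶜ ∩ E)).Reachable s r)) →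
      ∀ u ∈ R, ∀ v ∈ R, ∀ e, e ∈ ZoneSys.blk E (ζ T u) → e ∈ ZoneSys.blk E (ζ T v) → (β T u ↔ β T v))
    (hinv : ∀ T : Set (Sym2 V), (∀ r ∈ R, ¬ ((openGraph (T ∩ E)).Reachable s r ∧ (openGraph (Tᶜ ∩ E)).Reachable s r)) →
      ∀ M : Set (Sym2 V), (∀ r ∈ R, ¬ ((openGraph (M ∩ E)).Reachable s r ∧ (openGraph (Mᶜ ∩ E)).Reachable s r)) →
      (∀ u ∈ R, (∀ e ∈ ZoneSys.blk E (ζ T u), (e ∈ M ↔ e ∈ T)) ∨ (∀ e ∈ ZoneSys.blk E (ζ T u), (e ∈ M ↔ e ∉ T))) →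
      ∀ u ∈ R, ζ M u = ζ T u ∧
        (((∀ e ∈ ZoneSys.blk E (ζ T u), (e ∈ M ↔ e ∈ T)) ∧ (β M u ↔ β T u)) ∨
          ((∀ e ∈ ZoneSys.blk E (ζ T u), (e ∈ M ↔ e ∉ T)) ∧ (β M u ↔ ¬ β T u))))
    {F G : Set (Sym2 V) → ℝ} (hF : Monotone F) (hG : Monotone G) :
    0 ≤ ∑ ω ∈ Finset.univ.filter (fun ω : Set (Sym2 V) =>
        ∀ r ∈ R, ¬ ((openGraph (ω ∩ E)).Reachable s r ∧ (openGraph (ωᶜ ∩ E)).Reachable s r)),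
      (F (openEdgeCluster (ω ∩ E) s) - F (openEdgeCluster (ωᶜ ∩ E) s)) *
        (G (openEdgeCluster (ω ∩ E) s) - G (openEdgeCluster (ωᶜ ∩ E) s)) := by
  refine sum_nonneg_of_parts _ _ (fun T => ZoneSys.part E R (ζ T) (β T) T) ?_ ?_ ?_ ?_
  · intro T hT
    rw [Finset.mem_filter] at hT
    exact ZoneSys.mem_part_self (hcons T hT.2)
  · intro T hT M hM
    rw [Finset.mem_filter] at hT ⊢
    exact ⟨Finset.mem_univ _, ZoneSys.mem_constraint_of_mem_part (hself T hT.2) (hs T hT.2) (hbd T hT.2) (hcons T hT.2) hM⟩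
  · intro T hT M hM
    rw [Finset.mem_filter] at hT
    have hMD := ZoneSys.mem_constraint_of_mem_part (hself T hT.2) (hs T hT.2) (hbd T hT.2) (hcons T hT.2) hM
    exact ZoneSys.part_eq_of_inv (hinv T hT.2 M hMD (ZoneSys.agree_of_mem_part (hcons T hT.2) hM))
  · intro T hT
    rw [Finset.mem_filter] at hT
    exact ZoneSys.part_sum_nonneg (hs T hT.2) (hbd T hT.2) (hcons T hT.2) hF hG

end Theorem

end Antithetic

end Summit.CriticalPhenomena.PercolationContinuityZ3.Theorems
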